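import Summits.CriticalPhenomena.PercolationContinuityZ3.Theorems.Transplant.BoxProdZ2SeedKitDefs
import HarnessLib

/-!
# F6-prod, the seed kit of `X □ ℤ²` (axioms; resubmission of p212775 without local notation): the thick seeds of a tube level satisfy p2's `KNLevels.SHyp`, avoid the pairs of the shell,
# and their faces are inner-boundary faces of the thick cubes inside the shell (BLUEPRINT-I-PHI §1/§6; instance of `Transplant/KNLevelsStepIII.lean`)

builds on p205010 (kernel theorem, internal audit signed; external expert review pending) — nothing in this file uses p205010.
Lane `prim-bschramm`, seat `prim-bschramm-p3` (task F6 (b), split agreed with p2-g2 07:45Z/07:55Z); helper file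
(`--supports stmt-CriticalPhenomena-4575 --as helper`).

For the tube graph `G = tubeGraph X (B_X(xe, Rw))` and the tube levels `B⟨j⟩ = B_X(xe, Rw) × Icc (lo - j) (hi + j)` (`BoxProdZ2TubeLevels`),
the seed data `kitSData` of `BoxProdZ2SeedKitDefs` satisfies Kozma–Nitzan's Step-III axioms `KNLevels.SHyp L j (kitSData …)` for every
level data `L = tubeLData X (B_X(xe,Rw)) lo hi o Sfin`, provided the level-`j` planar box is wide (`2M + 2 <` every side) and `nF ≤ Rw`:
* §1 lifting fibre paths to open paths at a fixed planar height; generic `|E(F)| ≤ Δ |F|`;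
* §2 the contact data of a candidate contact (`kit_contact`), and the five geometric facts about a thick seed edge: it is an edge of the tube
  graph, it touches `B⟨j⟩`, its endpoints are near the contact (fibre distance `≤ 2nF+1`, planar sup-distance `≤ 2M+4`), and one endpoint has
  planar depth `≤ 0` (`seed_avoid_shrink`: not both endpoints in `π × Icc (Lo+1) (Hi-1)`);
* §3 **`shyp_kit`**: `SHyp` (edges, within `B⟨j+1⟩`, touch, `card ≤ kitSB`, open seed ⇒ `x ↔` every vertex of the thick face, `pick`);
* §4 for Steps IV–V: `kitSeed_notMem_wireSet` (seeds avoid the pairs inside any `π' × T`, `T ⊆ Icc (Lo+1) (Hi-1)`), `kitFace_subset_kitCube`,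
  `kitCube_subset_shell` (cube `⊆ π × (Icc (Lo+1) (Hi-1) \ Icc (Lo+2M+2) (Hi-2M-2))`), `kitFace_subset_innerBoundary_kitCube`.

[cite: KozmaNitzan2024, §4 Lemma 10, p. 19 (Step III, seeds), p. 21 (U(P), "Q ⊆ S") — the ℤ^d model] [cite: GrimmettPercolation1999, §7.2]
-/

noncomputable section

namespace Summit.CriticalPhenomena.PercolationContinuityZ3.Theorems

namespace Transplant

namespace BoxProdZ2

open Literature.Probability.Percolation Literature.Probability.LatticeModels SimpleGraph
open Literature.Probability.Percolation.KozmaNitzan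
open Literature.Barriers.CriticalPhenomena (graphBall graphBall_finite mem_graphBall_self graphBall_mono)
open KNLevels

variable {W : Type*} [DecidableEq W] {X : SimpleGraph W} [X.LocallyFinite]

/-! ## §1 Two generic helpers -/

omit [DecidableEq W] [X.LocallyFinite] in
/-- **Lifting a fibre path to an open path at height `z`**: if every `X`-edge inside `F`, placed at planar height `z`, is open in `ω`,
then a path of `X` inside `F` from `a` to `b` gives `(a, z) ↔ (b, z)` in `ω`. [folklore] -/
theorem reachable_lift_of_pathIn [DecidableEq W] [X.LocallyFinite] {F : Finset W} {z : Site 2} {ω : BondConfig (W × Site 2)}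
    (hω : ∀ e₀ ∈ edgesIn X F, Sym2.map (fun b : W => (b, z)) e₀ ∈ ω) {a b : W} (h : PathIn X (↑F : Set W) a b) :
    (openGraph ω).Reachable (a, z) (b, z) := by
  obtain ⟨ha, hp⟩ := h
  induction hp with
  | refl => exact SimpleGraph.Reachable.refl _
  | @tail u v huv hv ih =>
    have hu : u ∈ (↑F : Set W) := (show PathIn X (↑F : Set W) a u from ⟨ha, huv⟩).right_mem
    refine ih.trans (SimpleGraph.Adj.reachable ?_)
    rw [openGraph_adj]
    refine ⟨?_, fun h' => hv.1.ne (Prod.mk.inj h').1⟩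
    have he : s(u, v) ∈ edgesIn X F := by
      rw [mem_edgesIn_iff]
      refine ⟨(SimpleGraph.mem_edgeSet (G := X)).2 hv.1, fun w hw => ?_⟩
      rcases Sym2.mem_iff.1 hw with rfl | rfl
      · exact Finset.mem_coe.1 hu
      · exact Finset.mem_coe.1 hv.2
    have := hω _ he
    rwa [Sym2.map_mk] at this

/-- `|E(F)| ≤ Δ · |F|` for a graph with degrees `≤ Δ`. [folklore] -/
theorem card_edgesIn_le_degree {Δ : ℕ} (hΔ : ∀ w, X.degree w ≤ Δ) (F : Finset W) : (edgesIn X F).card ≤ Δ * F.card := by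
  calc (edgesIn X F).card ≤ (edgesTouching X F).card := Finset.card_le_card (edgesIn_subset_edgesTouching F)
    _ ≤ ∑ x ∈ F, (X.incidenceFinset x).card := Finset.card_biUnion_le
    _ ≤ ∑ _x ∈ F, Δ := Finset.sum_le_sum fun x _ => by rw [SimpleGraph.card_incidenceFinset_eq_degree]; exact hΔ x
    _ = Δ * F.card := by rw [Finset.sum_const, smul_eq_mul, mul_comm]

/-! ## §2 Contact data and the geometry of a thick seed edge -/

section Kit

variable {xe : W} {Rw : ℕ} {lo hi : Site 2} {j M nF : ℕ}

/-- **The data of a candidate contact** `x` of the tube level `j`: its fibre coordinate lies in the window, and its planar coordinate has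
planar window data `WinHyp` with `x.2 = y + σ e_i`. [cite: KozmaNitzan2024, §4 pp. 19–21] -/
theorem kit_contact (hwide : ∀ k, (lo - ((j : ℕ) : Site 2)) k + 2 * M + 2 ≤ (hi + ((j : ℕ) : Site 2)) k) {x : W × Site 2}
    (hx : x ∈ outerBoundary (tubeGraph X (ballFin X xe Rw)) (tubeLevel (ballFin X xe Rw) lo hi j)) :
    x.1 ∈ graphBall X xe Rw ∧
      WinHyp (lo - ((j : ℕ) : Site 2)) (hi + ((j : ℕ) : Site 2)) M (pwin (lo - ((j : ℕ) : Site 2)) (hi + ((j : ℕ) : Site 2)) M x.2).1 (pwin (lo - ((j : ℕ) : Site 2))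
          (hi + ((j : ℕ) : Site 2)) M x.2).2.1 (pwin (lo - ((j : ℕ) : Site 2)) (hi + ((j : ℕ) : Site 2)) M x.2).2.2 ∧
      x.2 = (pwin (lo - ((j : ℕ) : Site 2)) (hi + ((j : ℕ) : Site 2)) M x.2).2.2 + (pwin (lo - ((j : ℕ) : Site 2))
          (hi + ((j : ℕ) : Site 2)) M x.2).2.1 • unitVec (pwin (lo - ((j : ℕ) : Site 2)) (hi + ((j : ℕ) : Site 2)) M x.2).1 := by
  obtain ⟨h1, h2⟩ := (mem_outerBoundary_tubeLevel_iff X).1 hx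
  exact ⟨(mem_ballFin X).1 h1, pwin_spec hwide h2⟩

/-- **Thick seed edges are edges of the tube graph.** [cite: KozmaNitzan2024, §4 p. 19] -/
theorem kitSeed_mem_edgeSet (hwide : ∀ k, (lo - ((j : ℕ) : Site 2)) k + 2 * M + 2 ≤ (hi + ((j : ℕ) : Site 2)) k) (hnF : nF ≤ Rw) {x : W × Site 2}
    (hx : x ∈ outerBoundary (tubeGraph X (ballFin X xe Rw)) (tubeLevel (ballFin X xe Rw) lo hi j))
        {e : Sym2 (W × Site 2)} (he : e ∈ kitSeed X xe Rw (lo - ((j : ℕ) : Site 2)) (hi + ((j : ℕ) : Site 2)) M nF x) :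
    e ∈ (tubeGraph X (ballFin X xe Rw)).edgeSet := by
  obtain ⟨hw, hW, hx2⟩ := kit_contact hwide hx
  have hwπ : x.1 ∈ (ballFin X xe Rw) := (mem_ballFin X).2 hw
  rcases mem_kitSeed_cases he with ⟨e₀, he₀, rfl⟩ | ⟨z, hz, e₀, he₀, rfl⟩ | ⟨b, hb, z, hz, rfl⟩
  · have h0 := seedEdges_subset_edgeSet hW (Finset.mem_coe.2 he₀)
    induction e₀ using Sym2.ind with
    | h a b =>
      rw [Sym2.map_mk, SimpleGraph.mem_edgeSet]
      exact (tubeGraph_adj X).2 ⟨ProdKN.adj_slice X x.1 ((SimpleGraph.mem_edgeSet (G := zdGraph 2)).1 h0), hwπ, hwπ⟩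
  · obtain ⟨h0, hF⟩ := mem_edgesIn_iff.1 he₀
    rw [fibSetT_eq X nF hw] at hF
    induction e₀ using Sym2.ind with
    | h a b =>
      rw [Sym2.map_mk, SimpleGraph.mem_edgeSet]
      refine (tubeGraph_adj X).2 ⟨ProdKN.adj_fibre X z ((SimpleGraph.mem_edgeSet (G := X)).1 h0), ?_, ?_⟩
      · exact fibSet_subset_window X hw hnF (hF a (Sym2.mem_mk_left a b))
      · exact fibSet_subset_window X hw hnF (hF b (Sym2.mem_mk_right a b))
  · rw [SimpleGraph.mem_edgeSet]
    rw [fibCtrT_eq X nF hw] at hb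
    have hbπ : b ∈ (ballFin X xe Rw) := (mem_ballFin X).2 (graphBall_fibCtr_subset_window X hw hnF ((mem_ballFin X).1 hb))
    refine (tubeGraph_adj X).2 ⟨ProdKN.adj_slice X b ?_, hbπ, hbπ⟩
    refine adj_iff_exists_sign.2 ⟨(pwin (lo - ((j : ℕ) : Site 2)) (hi + ((j : ℕ) : Site 2)) M x.2).1, -(pwin (lo - ((j : ℕ) : Site 2)) (hi + ((j : ℕ) : Site 2)) M x.2).2.1, ?_, ?_⟩
    · rcases hW.sign with hs | hs <;> simp [hs]
    · rw [neg_smul, sub_eq_add_neg]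

/-- **Every thick seed edge has an endpoint in `B⟨j⟩`.** [cite: KozmaNitzan2024, §4 p. 19 ("also after conditioning on C(o; G \ B⟨j⟩)")] -/
theorem kitSeed_touch (hwide : ∀ k, (lo - ((j : ℕ) : Site 2)) k + 2 * M + 2 ≤ (hi + ((j : ℕ) : Site 2)) k) (hnF : nF ≤ Rw) {x : W × Site 2}
    (hx : x ∈ outerBoundary (tubeGraph X (ballFin X xe Rw)) (tubeLevel (ballFin X xe Rw) lo hi j))
        {e : Sym2 (W × Site 2)} (he : e ∈ kitSeed X xe Rw (lo - ((j : ℕ) : Site 2)) (hi + ((j : ℕ) : Site 2)) M nF x) :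
    ∃ v ∈ e, v ∈ tubeLevel (ballFin X xe Rw) lo hi j := by
  obtain ⟨hw, hW, hx2⟩ := kit_contact hwide hx
  have hwπ : x.1 ∈ (ballFin X xe Rw) := (mem_ballFin X).2 hw
  rcases mem_kitSeed_cases he with ⟨e₀, he₀, rfl⟩ | ⟨z, hz, e₀, he₀, rfl⟩ | ⟨b, hb, z, hz, rfl⟩
  · obtain ⟨t, ht, htI⟩ := exists_mem_Icc_of_mem_seedEdges hW he₀
    exact ⟨(x.1, t), Sym2.mem_map.2 ⟨t, ht, rfl⟩, (mem_tubeLevel_iff).2 ⟨hwπ, htI⟩⟩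
  · obtain ⟨-, hF⟩ := mem_edgesIn_iff.1 he₀
    rw [fibSetT_eq X nF hw] at hF
    induction e₀ using Sym2.ind with
    | h a b =>
      refine ⟨(a, z), by rw [Sym2.map_mk]; exact Sym2.mem_mk_left _ _, (mem_tubeLevel_iff).2 ⟨?_, ?_⟩⟩
      · exact fibSet_subset_window X hw hnF (hF a (Sym2.mem_mk_left a b))
      · exact wreg_subset_Icc hW (plaq_subset_wreg hz)
  · rw [fibCtrT_eq X nF hw] at hb
    refine ⟨(b, z), Sym2.mem_mk_left _ _, (mem_tubeLevel_iff).2 ⟨?_, wreg_subset_Icc hW (plaq_subset_wreg hz)⟩⟩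
    exact (mem_ballFin X).2 (graphBall_fibCtr_subset_window X hw hnF ((mem_ballFin X).1 hb))

/-- **Locality of a thick seed**: every endpoint of a seed edge of `x = (w, t)` has fibre coordinate in `B_X(w, 2nF+1)` and planar
coordinate within sup-distance `2M + 4` of `t`. [folklore] -/
theorem kitSeed_endpoint_near (hwide : ∀ k, (lo - ((j : ℕ) : Site 2)) k + 2 * M + 2 ≤ (hi + ((j : ℕ) : Site 2)) k) {x : W × Site 2}
    (hx : x ∈ outerBoundary (tubeGraph X (ballFin X xe Rw)) (tubeLevel (ballFin X xe Rw) lo hi j))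
        {e : Sym2 (W × Site 2)} (he : e ∈ kitSeed X xe Rw (lo - ((j : ℕ) : Site 2)) (hi + ((j : ℕ) : Site 2)) M nF x)
    {v : W × Site 2} (hv : v ∈ e) : v.1 ∈ graphBall X x.1 (2 * nF + 1) ∧ v.2 - x.2 ∈ box 2 (2 * M + 4) := by
  obtain ⟨hw, hW, hx2⟩ := kit_contact hwide hx
  -- planar points of the plaquette and of its inward translate are near `x.2`
  have hplanar : ∀ z ∈ plaq (lo - ((j : ℕ) : Site 2)) (hi + ((j : ℕ) : Site 2)) M (pwin (lo - ((j : ℕ) : Site 2))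
      (hi + ((j : ℕ) : Site 2)) M x.2).1 (pwin (lo - ((j : ℕ) : Site 2)) (hi + ((j : ℕ) : Site 2)) M x.2).2.2, ∀ t ∈ s(z, z - (pwin (lo - ((j : ℕ) : Site 2))
          (hi + ((j : ℕ) : Site 2)) M x.2).2.1 • unitVec (pwin (lo - ((j : ℕ) : Site 2)) (hi + ((j : ℕ) : Site 2)) M x.2).1),
      t - x.2 ∈ box 2 (2 * M + 4) := by
    intro z hz t ht
    rw [hx2]
    exact sub_mem_box_of_mem_seedEdges hW (mem_seedEdges_iff.2 (Or.inr (Or.inl ⟨z, hz, rfl⟩))) ht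
  rcases mem_kitSeed_cases he with ⟨e₀, he₀, rfl⟩ | ⟨z, hz, e₀, he₀, rfl⟩ | ⟨b, hb, z, hz, rfl⟩
  · obtain ⟨t, ht, rfl⟩ := Sym2.mem_map.1 hv
    refine ⟨mem_graphBall_self X x.1 _, ?_⟩
    rw [hx2]; exact sub_mem_box_of_mem_seedEdges hW he₀ ht
  · obtain ⟨a, ha, rfl⟩ := Sym2.mem_map.1 hv
    obtain ⟨-, hF⟩ := mem_edgesIn_iff.1 he₀
    rw [fibSetT_eq X nF hw] at hF
    exact ⟨(mem_ballFin X).1 (fibSet_subset_ballFin_self X hw nF (hF a ha)), hplanar z hz z (Sym2.mem_mk_left _ _)⟩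
  · rw [fibCtrT_eq X nF hw] at hb
    have hb' : b ∈ graphBall X x.1 (2 * nF + 1) :=
      (mem_ballFin X).1 (fibSet_subset_ballFin_self X hw nF (ballFin_fibCtr_subset_fibSet X hw nF hb))
    rcases Sym2.mem_iff.1 hv with rfl | rfl
    · exact ⟨hb', hplanar z hz z (Sym2.mem_mk_left _ _)⟩
    · exact ⟨hb', hplanar z hz _ (Sym2.mem_mk_right _ _)⟩

/-- **Thick seeds have planar depth `≤ 0`**: every seed edge has an endpoint whose planar coordinate is NOT in the shrunken box
`Icc (Lo+1) (Hi-1)` (so seed events are unaffected by conditioning on the shell). [cite: KozmaNitzan2024, §4 p. 21 ("P_{K_ξ}(F_P) = P_G(F_P)")] -/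
theorem kitSeed_avoid_shrink (hwide : ∀ k, (lo - ((j : ℕ) : Site 2)) k + 2 * M + 2 ≤ (hi + ((j : ℕ) : Site 2)) k) {x : W × Site 2}
    (hx : x ∈ outerBoundary (tubeGraph X (ballFin X xe Rw)) (tubeLevel (ballFin X xe Rw) lo hi j))
        {e : Sym2 (W × Site 2)} (he : e ∈ kitSeed X xe Rw (lo - ((j : ℕ) : Site 2)) (hi + ((j : ℕ) : Site 2)) M nF x) :
    ∃ v ∈ e, v.2 ∉ Finset.Icc ((lo - ((j : ℕ) : Site 2)) + 1) ((hi + ((j : ℕ) : Site 2)) - 1) := by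
  obtain ⟨hw, hW, hx2⟩ := kit_contact hwide hx
  rcases mem_kitSeed_cases he with ⟨e₀, he₀, rfl⟩ | ⟨z, hz, e₀, he₀, rfl⟩ | ⟨b, hb, z, hz, rfl⟩
  · obtain ⟨t, ht, htI⟩ := exists_not_mem_shrink_of_mem_seedEdges hW he₀
    exact ⟨(x.1, t), Sym2.mem_map.2 ⟨t, ht, rfl⟩, htI⟩
  · induction e₀ using Sym2.ind with
    | h a b =>
      exact ⟨(a, z), by rw [Sym2.map_mk]; exact Sym2.mem_mk_left _ _, not_mem_shrink_of_mem_wreg hW (plaq_subset_wreg hz)⟩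
  · exact ⟨(b, z), Sym2.mem_mk_left _ _, not_mem_shrink_of_mem_wreg hW (plaq_subset_wreg hz)⟩

/-- The plaquette at `d = 2` has at most `(2M+3)^2` points. [folklore] -/
theorem card_plaq_le (hwide : ∀ k, (lo - ((j : ℕ) : Site 2)) k + 2 * M + 2 ≤ (hi + ((j : ℕ) : Site 2)) k) {x : W × Site 2}
    (hx : x ∈ outerBoundary (tubeGraph X (ballFin X xe Rw)) (tubeLevel (ballFin X xe Rw) lo hi j)) :
    (plaq (lo - ((j : ℕ) : Site 2)) (hi + ((j : ℕ) : Site 2)) M (pwin (lo - ((j : ℕ) : Site 2)) (hi + ((j : ℕ) : Site 2)) M x.2).1 (pwin (lo - ((j : ℕ) : Site 2))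
        (hi + ((j : ℕ) : Site 2)) M x.2).2.2).card ≤ (2 * M + 3) ^ 2 := by
  obtain ⟨-, hW, -⟩ := kit_contact hwide hx
  unfold plaq
  refine card_Icc_le_pow fun k => ?_
  rcases eq_or_ne k (pwin (lo - ((j : ℕ) : Site 2)) (hi + ((j : ℕ) : Site 2)) M x.2).1 with rfl | hk
  · simp only [Function.update_self]; omega
  · simp only [Function.update_of_ne hk, Pi.add_apply, Pi.sub_apply, Pi.natCast_apply]; omega

/-- **Size of a thick seed**: at most `kitSB Δ M nF` edges. [cite: KozmaNitzan2024, §4 p. 19 ("at least p^{(d+1)(4M)^{d-1}}")] -/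
theorem card_kitSeed_le {Δ : ℕ} (hΔ : ∀ w, X.degree w ≤ Δ) (hwide : ∀ k, (lo - ((j : ℕ) : Site 2)) k + 2 * M + 2 ≤ (hi + ((j : ℕ) : Site 2)) k) {x : W × Site 2}
    (hx : x ∈ outerBoundary (tubeGraph X (ballFin X xe Rw)) (tubeLevel (ballFin X xe Rw) lo hi j)) :
    (kitSeed X xe Rw (lo - ((j : ℕ) : Site 2)) (hi + ((j : ℕ) : Site 2)) M nF x).card ≤ kitSB Δ M nF := by
  obtain ⟨hw, hW, -⟩ := kit_contact hwide hx
  have hP := card_plaq_le hwide hx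
  have hF : (fibSetT X xe Rw nF x.1).card ≤ nF + 2 + (Δ + 1) ^ nF := by
    rw [fibSetT_eq X nF hw]; exact card_fibSet_le X hΔ hw nF
  have hB : (ballFin X (fibCtrT X xe Rw nF x.1) nF).card ≤ (Δ + 1) ^ nF := card_ballFin_le X hΔ _ nF
  unfold kitSeed kitSB
  refine (Finset.card_union_le _ _).trans (add_le_add ((Finset.card_union_le _ _).trans (add_le_add ?_ ?_)) ?_)
  · exact Finset.card_image_le.trans card_seedEdges_le
  · refine Finset.card_biUnion_le.trans ?_
    calc _ ≤ ∑ _z ∈ plaq (lo - ((j : ℕ) : Site 2)) (hi + ((j : ℕ) : Site 2)) M (pwin (lo - ((j : ℕ) : Site 2))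
        (hi + ((j : ℕ) : Site 2)) M x.2).1 (pwin (lo - ((j : ℕ) : Site 2)) (hi + ((j : ℕ) : Site 2)) M x.2).2.2, Δ * (nF + 2 + (Δ + 1) ^ nF) :=
          Finset.sum_le_sum fun z _ => Finset.card_image_le.trans
            ((card_edgesIn_le_degree hΔ _).trans (Nat.mul_le_mul_left _ hF))
      _ ≤ (2 * M + 3) ^ 2 * (Δ * (nF + 2 + (Δ + 1) ^ nF)) := by
          rw [Finset.sum_const, smul_eq_mul]; exact Nat.mul_le_mul_right _ hP
  · refine Finset.card_image_le.trans ?_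
    rw [Finset.card_product]
    exact Nat.mul_le_mul hB hP

/-- **An open thick seed joins the contact vertex to every vertex of the thick face** (through the slice seed to `(w, u₂)`, up the planar
rung to the plaquette height `z = u₂ + σ e_i`, along the open fibre edges at height `z` to `(b, z)`, down the thick rung to `(b, u₂)`).
[cite: KozmaNitzan2024, §4 p. 21 ("P connects to w")] -/
theorem openConn_of_kitSeed_subset (hwide : ∀ k, (lo - ((j : ℕ) : Site 2)) k + 2 * M + 2 ≤ (hi + ((j : ℕ) : Site 2)) k) {x : W × Site 2}
    (hx : x ∈ outerBoundary (tubeGraph X (ballFin X xe Rw)) (tubeLevel (ballFin X xe Rw) lo hi j)) {ω : BondConfig (W × Site 2)}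
    (hω : (↑(kitSeed X xe Rw (lo - ((j : ℕ) : Site 2)) (hi + ((j : ℕ) : Site 2)) M nF x) : Set (Sym2 (W × Site 2))) ⊆ ω)
        {u : W × Site 2} (hu : u ∈ kitFace X xe Rw (lo - ((j : ℕ) : Site 2)) (hi + ((j : ℕ) : Site 2)) M nF x) :
    ω ∈ openConn x u := by
  obtain ⟨hw, hW, hx2⟩ := kit_contact hwide hx
  obtain ⟨hb, hu2⟩ := (mem_kitFace_iff).1 hu
  set i := (pwin (lo - ((j : ℕ) : Site 2)) (hi + ((j : ℕ) : Site 2)) M x.2).1 with hi_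
  set σ := (pwin (lo - ((j : ℕ) : Site 2)) (hi + ((j : ℕ) : Site 2)) M x.2).2.1 with hσ
  set y := (pwin (lo - ((j : ℕ) : Site 2)) (hi + ((j : ℕ) : Site 2)) M x.2).2.2 with hy
  set z : Site 2 := u.2 + σ • unitVec i with hz
  have hzP : z ∈ plaq (lo - ((j : ℕ) : Site 2)) (hi + ((j : ℕ) : Site 2)) M i y := (mem_uface_iff).1 hu2
  have hxeq : x = (x.1, y + σ • unitVec i) := Prod.ext rfl hx2
  -- (1) the slice seed: `x ↔ (x.1, u.2)`
  have h1 : ω ∈ openConn x (x.1, u.2) := by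
    rw [hxeq]
    exact ProdKN.openConn_slice_of_seedEdges_subset hW x.1 (fun e he => hω (sliceSeed_subset_kitSeed he)) hu2
  -- (2) the planar rung in the slice: `(x.1, u.2) — (x.1, z)`
  have h2 : (openGraph ω).Adj (x.1, u.2) (x.1, z) := by
    rw [openGraph_adj]
    refine ⟨?_, fun h' => ?_⟩
    · have hmem : s(z, z - σ • unitVec i) ∈ seedEdges (lo - ((j : ℕ) : Site 2)) (hi + ((j : ℕ) : Site 2)) M i σ y := mem_seedEdges_iff.2 (Or.inr (Or.inl ⟨z, hzP, rfl⟩))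
      have := hω (sliceSeed_subset_kitSeed (Finset.mem_image.2 ⟨_, hmem, rfl⟩))
      rw [Sym2.map_mk, hz, add_sub_cancel_right] at this
      rwa [Sym2.eq_swap]
    · have h2 : u.2 i = z i := congrFun (congrArg Prod.snd h') i
      rw [hz, add_smul_unitVec_apply, if_pos rfl] at h2
      rcases hW.sign with hs | hs <;> rw [hs] at h2 <;> omega
  -- (3) along the fibre at height `z`: `(x.1, z) ↔ (u.1, z)`
  have h3 : (openGraph ω).Reachable (x.1, z) (u.1, z) := by
    refine reachable_lift_of_pathIn (F := fibSetT X xe Rw nF x.1) (fun e₀ he₀ => hω (fibreSeed_mem_kitSeed hzP he₀)) ?_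
    rw [fibSetT_eq X nF hw]
    rw [fibCtrT_eq X nF hw] at hb
    exact pathIn_fibSet X hw nF (ballFin_fibCtr_subset_fibSet X hw nF hb)
  -- (4) the thick rung: `(u.1, z) — (u.1, u.2) = u`
  have h4 : (openGraph ω).Adj (u.1, z) u := by
    rw [openGraph_adj]
    refine ⟨?_, fun h' => ?_⟩
    · have := hω (rung_mem_kitSeed hb hzP)
      rwa [hz, add_sub_cancel_right] at this
    · have h2 : z i = u.2 i := congrFun (congrArg Prod.snd h') i
      rw [hz, add_smul_unitVec_apply, if_pos rfl] at h2
      rcases hW.sign with hs | hs <;> rw [hs] at h2 <;> omega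
  exact h1.trans (h2.reachable.trans (h3.trans h4.reachable))

/-- **Far candidate contacts have disjoint thick seeds**: if `y ∉ kitNear x` then the seeds of `x` and `y` share no edge. [cite: KozmaNitzan2024, §4 p. 19 ("the seeds are independent")] -/
theorem disjoint_kitSeed_of_not_near (hwide : ∀ k, (lo - ((j : ℕ) : Site 2)) k + 2 * M + 2 ≤ (hi + ((j : ℕ) : Site 2)) k) {x y : W × Site 2}
    (hx : x ∈ outerBoundary (tubeGraph X (ballFin X xe Rw)) (tubeLevel (ballFin X xe Rw) lo hi j)) (hy : y ∈ outerBoundary (tubeGraph X (ballFin X xe Rw))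
        (tubeLevel (ballFin X xe Rw) lo hi j))
    (hfar : y ∉ kitNear X M nF x) : Disjoint (kitSeed X xe Rw (lo - ((j : ℕ) : Site 2)) (hi + ((j : ℕ) : Site 2)) M nF x) (kitSeed X xe Rw (lo - ((j : ℕ) : Site 2))
        (hi + ((j : ℕ) : Site 2)) M nF y) := by
  rw [Finset.disjoint_left]
  intro e hex hey
  apply hfar
  induction e using Sym2.ind with
  | h a b =>
    obtain ⟨ha1, ha2⟩ := kitSeed_endpoint_near hwide hx hex (Sym2.mem_mk_left a b)
    obtain ⟨ha1', ha2'⟩ := kitSeed_endpoint_near hwide hy hey (Sym2.mem_mk_left a b)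
    rw [mem_kitNear_iff]
    refine ⟨(mem_ballFin X).2 ?_, ?_⟩
    · have h := mem_graphBall_add X ha1 ((mem_graphBall_comm X).1 ha1')
      exact graphBall_mono X x.1 (by omega) h
    · rw [mem_box] at ha2 ha2' ⊢
      intro k
      have h1 := ha2 k; have h2 := ha2' k
      simp only [Pi.sub_apply] at h1 h2 ⊢
      push_cast at h1 h2 ⊢
      omega

/-! ## §3 The Step-III axioms -/

/-- **The thick seed kit satisfies Kozma–Nitzan's Step-III axioms** `KNLevels.SHyp` at the tube level `j` (planar box of level `j` wide,
`nF ≤ Rw`), for any source `o` and support `Sfin`. [cite: KozmaNitzan2024, §4 p. 19 (Step III)] -/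
theorem shyp_kit {Δ : ℕ} (hΔ : ∀ w, X.degree w ≤ Δ) (hwide : ∀ k, (lo - ((j : ℕ) : Site 2)) k + 2 * M + 2 ≤ (hi + ((j : ℕ) : Site 2)) k) (hnF : nF ≤ Rw) (k : ℕ)
    (o : W × Site 2) (Sfin : Finset (W × Site 2)) :
    SHyp (tubeLData X (ballFin X xe Rw) lo hi o Sfin) j (kitSData X hΔ xe Rw lo hi j M nF k) where
  Kont_sub ω := LData.Kont_subset j ω
  edge x hx e he := kitSeed_mem_edgeSet hwide hnF hx he
  within x hx e he := by
    intro v hv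
    have hedge := kitSeed_mem_edgeSet hwide hnF hx he
    obtain ⟨v₀, hv₀, hv₀X⟩ := kitSeed_touch hwide hnF hx he
    change v ∈ tubeLevel (ballFin X xe Rw) lo hi (j + 1)
    by_cases hvv : v = v₀
    · rw [hvv]; exact tubeLevel_monotone (ballFin X xe Rw) lo hi (Nat.le_succ j) hv₀X
    · by_cases hvX : v ∈ tubeLevel (ballFin X xe Rw) lo hi j
      · exact tubeLevel_monotone (ballFin X xe Rw) lo hi (Nat.le_succ j) hvX
      · refine tubeLevel_nest X (ballFin X xe Rw) lo hi j (mem_outerBoundary_iff.2 ⟨hvX, v₀, hv₀X, ?_⟩)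
        have hpair : e = s(v, v₀) := (Sym2.mem_and_mem_iff hvv).1 ⟨hv, hv₀⟩
        rw [hpair] at hedge
        exact (SimpleGraph.mem_edgeSet (G := tubeGraph X (ballFin X xe Rw))).1 hedge
  touch x hx e he := kitSeed_touch hwide hnF hx he
  card_le x hx := card_kitSeed_le hΔ hwide hx
  conn x hx ω hω u hu := openConn_of_kitSeed_subset hwide hx hω hu
  pick_sub κ := kitSData_pick_subset X hΔ xe Rw lo hi j M nF k κ
  pick_card κ _ hκ := (kitSData_pick_spec X hΔ xe Rw lo hi j M nF k hκ).1
  pick_disj κ hκK hκ := by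
    change (↑(apartSel (kitNear X M nF) (mem_kitNear_self M nF) (kitNear_symm M nF) (kitB_pos Δ M nF)
      (card_kitNear_le hΔ M nF) k κ) : Set (W × Site 2)).PairwiseDisjoint (kitSeed X xe Rw (lo - ((j : ℕ) : Site 2)) (hi + ((j : ℕ) : Site 2)) M nF)
    exact pairwiseDisjoint_apartSel _ _ _ _ _ hκ fun x hx' y hy' hfar =>
      disjoint_kitSeed_of_not_near hwide (hκK hx') (hκK hy') hfar

/-! ## §4 For Steps IV–V: avoidance of the shell, the thick cube, its shell, its face -/

/-- **Thick seeds avoid the pairs of the shell**: no seed edge of a candidate contact is a pair inside `π' × T` whenever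
`T ⊆ Icc (Lo+1) (Hi-1)`. [cite: KozmaNitzan2024, §4 p. 21] -/
theorem kitSeed_notMem_wireSet (hwide : ∀ k, (lo - ((j : ℕ) : Site 2)) k + 2 * M + 2 ≤ (hi + ((j : ℕ) : Site 2)) k) {x : W × Site 2}
    (hx : x ∈ outerBoundary (tubeGraph X (ballFin X xe Rw)) (tubeLevel (ballFin X xe Rw) lo hi j)) {π' : Finset W} {T : Finset (Site 2)}
    (hT : T ⊆ Finset.Icc ((lo - ((j : ℕ) : Site 2)) + 1) ((hi + ((j : ℕ) : Site 2)) - 1)) {e : Sym2 (W × Site 2)} (he : e ∈ kitSeed X xe Rw (lo - ((j : ℕ) : Site 2))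
        (hi + ((j : ℕ) : Site 2)) M nF x) :
    e ∉ wireSet (↑(π' ×ˢ T) : Set (W × Site 2)) := by
  obtain ⟨v, hv, hvT⟩ := kitSeed_avoid_shrink hwide hx he
  intro hw
  exact hvT (hT (Finset.mem_product.1 (Finset.mem_coe.1 (hw.1 v hv))).2)

/-- The thick face lies in the thick cube. [folklore] -/
theorem kitFace_subset_kitCube (hwide : ∀ k, (lo - ((j : ℕ) : Site 2)) k + 2 * M + 2 ≤ (hi + ((j : ℕ) : Site 2)) k) {x : W × Site 2}
    (hx : x ∈ outerBoundary (tubeGraph X (ballFin X xe Rw)) (tubeLevel (ballFin X xe Rw) lo hi j)) :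
    kitFace X xe Rw (lo - ((j : ℕ) : Site 2)) (hi + ((j : ℕ) : Site 2)) M nF x ⊆ kitCube X xe Rw (lo - ((j : ℕ) : Site 2)) (hi + ((j : ℕ) : Site 2)) M nF x := by
  obtain ⟨-, hW, -⟩ := kit_contact hwide hx
  exact Finset.product_subset_product le_rfl (uface_subset_cube hW)

/-- **The thick cube lies in the shell** `π × (Icc (Lo+1) (Hi-1) \ Icc (Lo + (2M+2)) (Hi - (2M+2)))` (KN: "`Q ⊆ S`"), `nF ≤ Rw`.
[cite: KozmaNitzan2024, §4 p. 19 ("v + [-M,M]^d ⊆ S")] -/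
theorem kitCube_subset_shell (hwide : ∀ k, (lo - ((j : ℕ) : Site 2)) k + 2 * M + 2 ≤ (hi + ((j : ℕ) : Site 2)) k) (hnF : nF ≤ Rw) {x : W × Site 2}
    (hx : x ∈ outerBoundary (tubeGraph X (ballFin X xe Rw)) (tubeLevel (ballFin X xe Rw) lo hi j)) :
    kitCube X xe Rw (lo - ((j : ℕ) : Site 2)) (hi + ((j : ℕ) : Site 2)) M nF x ⊆
      (ballFin X xe Rw) ×ˢ (Finset.Icc ((lo - ((j : ℕ) : Site 2)) + 1) ((hi + ((j : ℕ) : Site 2)) - 1) \ Finset.Icc ((lo - ((j : ℕ) : Site 2)) + ((2 * M + 2 : ℕ) : Site 2))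
          ((hi + ((j : ℕ) : Site 2)) - ((2 * M + 2 : ℕ) : Site 2))) := by
  obtain ⟨hw, hW, -⟩ := kit_contact hwide hx
  intro u hu
  obtain ⟨hu1, hu2⟩ := (mem_kitCube_iff).1 hu
  rw [fibCtrT_eq X nF hw] at hu1
  refine Finset.mem_product.2 ⟨?_, Finset.mem_sdiff.2 ⟨cube_subset_shrink hW hu2, not_mem_shrink2_of_mem_cube hW hu2⟩⟩
  exact (mem_ballFin X).2 (graphBall_fibCtr_subset_window X hw hnF ((mem_ballFin X).1 hu1))

/-- **The thick face is an inner-boundary face of the thick cube** in the tube graph (the planar neighbour `(b, u + σ e_i)` of a face vertex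
lies in the plaquette, outside the cube), `nF ≤ Rw`. [cite: KozmaNitzan2024, §4 p. 21 (U(P) ⊆ ∂Q)] -/
theorem kitFace_subset_innerBoundary_kitCube (hwide : ∀ k, (lo - ((j : ℕ) : Site 2)) k + 2 * M + 2 ≤ (hi + ((j : ℕ) : Site 2)) k) (hnF : nF ≤ Rw) {x : W × Site 2}
    (hx : x ∈ outerBoundary (tubeGraph X (ballFin X xe Rw)) (tubeLevel (ballFin X xe Rw) lo hi j)) :
    kitFace X xe Rw (lo - ((j : ℕ) : Site 2)) (hi + ((j : ℕ) : Site 2)) M nF x ⊆ innerBoundary (tubeGraph X (ballFin X xe Rw)) (kitCube X xe Rw (lo - ((j : ℕ) : Site 2))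
        (hi + ((j : ℕ) : Site 2)) M nF x) := by
  obtain ⟨hw, hW, -⟩ := kit_contact hwide hx
  intro u hu
  obtain ⟨hu1, hu2⟩ := (mem_kitFace_iff).1 hu
  have hz : u.2 + (pwin (lo - ((j : ℕ) : Site 2)) (hi + ((j : ℕ) : Site 2)) M x.2).2.1 • unitVec (pwin (lo - ((j : ℕ) : Site 2))
      (hi + ((j : ℕ) : Site 2)) M x.2).1 ∈ plaq (lo - ((j : ℕ) : Site 2)) (hi + ((j : ℕ) : Site 2)) M (pwin (lo - ((j : ℕ) : Site 2))
          (hi + ((j : ℕ) : Site 2)) M x.2).1 (pwin (lo - ((j : ℕ) : Site 2)) (hi + ((j : ℕ) : Site 2)) M x.2).2.2 :=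
    (mem_uface_iff).1 hu2
  have hbπ : u.1 ∈ (ballFin X xe Rw) := by
    rw [fibCtrT_eq X nF hw] at hu1
    exact (mem_ballFin X).2 (graphBall_fibCtr_subset_window X hw hnF ((mem_ballFin X).1 hu1))
  rw [mem_innerBoundary_iff]
  refine ⟨kitFace_subset_kitCube hwide hx hu, (u.1, u.2 + (pwin (lo - ((j : ℕ) : Site 2)) (hi + ((j : ℕ) : Site 2)) M x.2).2.1 • unitVec (pwin (lo - ((j : ℕ) : Site 2))
      (hi + ((j : ℕ) : Site 2)) M x.2).1), ?_, ?_⟩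
  · intro h'
    have h2 := ((mem_kitCube_iff).1 h').2
    exact not_mem_shrink_of_mem_wreg hW (plaq_subset_wreg hz) (cube_subset_shrink hW h2)
  · refine (tubeGraph_adj X).2 ⟨?_, hbπ, hbπ⟩
    have : (X □ zdGraph 2).Adj (u.1, u.2) (u.1, u.2 + (pwin (lo - ((j : ℕ) : Site 2)) (hi + ((j : ℕ) : Site 2)) M x.2).2.1 • unitVec (pwin (lo - ((j : ℕ) : Site 2))
        (hi + ((j : ℕ) : Site 2)) M x.2).1) :=
      ProdKN.adj_slice X u.1 (adj_iff_exists_sign.2 ⟨_, _, hW.sign, rfl⟩)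
    rwa [Prod.mk.eta] at this

end Kit

end BoxProdZ2

end Transplant

end Summit.CriticalPhenomena.PercolationContinuityZ3.Theorems

end
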